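import Literature.MathematicalPhysics.QuantumLattice.HubbardPolymerRepresentation
import Literature.MathematicalPhysics.QuantumLattice.HubbardPolymerBounds
import Literature.MathematicalPhysics.QuantumLattice.HubbardBondAlgebra
import HarnessLib

/-!
# Polymer representation of `Zc` for bond-dependent couplings (pub-hubbard BOUNDS, Theorem 12 —
# Lemma 12.2, generic part; KERNEL-PROVED support)

HONEST FRAMING: ladder R1–R4 with certified numbers; no claim on H/H₀; bounds for model classes, no
materials claim.

Cell `pub-hubbard`, LEAN FILING REQUEST #181 PART #181.4a (bounds g23; split off #181.4 for
`lint.size` by bounds g25, declarations byte-identical): for a finite ordered site set `Λ`, complex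
parameters `β U μ` with `z₀ = atomicPartitionFn β U μ ≠ 0` and ANY coupling `c : Bond Λ → ℂ`: the
restricted coupling `restrictCoupling c K`, the connected bond weights `bondWeightC`, the site
activities `siteActivityC P β U μ c`, the polymer identity `Zc = z₀^{|Λ|} · polymerGasZ` (Ueltschi
§2.3 for bond-dependent couplings), `bondWeightC` as an iterated difference and its Cauchy bound
`norm_bondWeightC_le`. The torus specialisation and the claim nodes are in
`Bounds/TwistedPolymerRepresentation.lean` (#181.4), which imports this file.

References: Ueltschi, arXiv:cond-mat/9810320 §2.1, §2.3, §3; Kotecký–Preiss, CMP 103 (1986) 491.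
-/

noncomputable section

namespace Summit.HubbardSuperconductivity.HubbardLadder.Bounds

open Matrix Finset Literature.MathematicalPhysics.QuantumLattice
  Literature.Probability.LatticeModels
  Literature.Analysis.Complex.FiniteDifference
open scoped ComplexConjugate

/-! ### Bond weights and the polymer representation for bond-dependent couplings -/

section General

variable {Λ : Type*} [LinearOrder Λ] [Fintype Λ]

/-- The coupling `c` restricted to the bond set `K` (zero outside). [folklore] -/
def restrictCoupling (c : Bond Λ → ℂ) (K : Finset (Bond Λ)) : Bond Λ → ℂ :=
  fun b => if b ∈ K then c b else 0

omit [Fintype Λ] in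
/-- Auxiliary lemma `restrictCoupling_apply` (support step for the results of this file; see the module docstring). -/
theorem restrictCoupling_apply (c : Bond Λ → ℂ) (K : Finset (Bond Λ)) (b : Bond Λ) :
    restrictCoupling c K b = if b ∈ K then c b else 0 := rfl

omit [Fintype Λ] in
/-- `c|_K` is supported on `K`. [folklore] -/
theorem mem_of_restrictCoupling_ne_zero {c : Bond Λ → ℂ} {K : Finset (Bond Λ)} {b : Bond Λ}
    (h : restrictCoupling c K b ≠ 0) : b ∈ K := by
  by_contra hb
  exact h (if_neg hb)

omit [Fintype Λ] in
/-- `c|_∅ = 0`. [folklore] -/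
theorem restrictCoupling_empty (c : Bond Λ → ℂ) : restrictCoupling c ∅ = 0 := by
  funext b
  simp [restrictCoupling_apply]

omit [Fintype Λ] in
/-- `c|_{K₁ ∪ K₂} = c|_{K₁} + c|_{K₂}` for disjoint bond sets. [folklore] -/
theorem restrictCoupling_union (c : Bond Λ → ℂ) {K₁ K₂ : Finset (Bond Λ)} (h : Disjoint K₁ K₂) :
    restrictCoupling c (K₁ ∪ K₂) = restrictCoupling c K₁ + restrictCoupling c K₂ := by
  funext b
  simp only [Pi.add_apply, restrictCoupling_apply, Finset.mem_union]
  by_cases h1 : b ∈ K₁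
  · have h2 : b ∉ K₂ := Finset.disjoint_left.1 h h1
    simp [h1, h2]
  · by_cases h2 : b ∈ K₂ <;> simp [h1, h2]

omit [Fintype Λ] in
/-- `c|_P = c` when `P` contains the support of `c`. [folklore] -/
theorem restrictCoupling_eq_self {c : Bond Λ → ℂ} {P : Finset (Bond Λ)} (hP : ∀ b, c b ≠ 0 → b ∈ P) :
    restrictCoupling c P = c := by
  funext b
  rw [restrictCoupling_apply]
  split_ifs with hb
  · rfl
  · by_contra h
    exact hb (hP b (fun h' => h (h'.symm ▸ rfl)))

/-- **The bond weight for a bond-dependent coupling** `M_c(K) = Σ_{K' ⊆ K} (-1)^{|K∖K'|} g(c|_{K'})`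
(`g = gibbsRatio`), the inclusion–exclusion analogue of Ueltschi's connected Duhamel terms; for
`c = τ·1` it is the tree's `bondWeight β U μ τ`. [cite: Ueltschi1999, §2.3 (definition of the polymer weights ρ(𝒜))] -/
def bondWeightC (β U μ : ℂ) (c : Bond Λ → ℂ) (K : Finset (Bond Λ)) : ℂ :=
  ∑ K' ∈ K.powerset, (-1) ^ (K \ K').card * gibbsRatio β U μ (restrictCoupling c K')

variable {β U μ : ℂ}

/-- `M_c(∅) = 1`. [folklore] -/
theorem bondWeightC_empty (hz : atomicPartitionFn β U μ ≠ 0) (c : Bond Λ → ℂ) :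
    bondWeightC β U μ c (∅ : Finset (Bond Λ)) = 1 := by
  rw [bondWeightC, Finset.powerset_empty, Finset.sum_singleton, Finset.sdiff_self, Finset.card_empty,
    pow_zero, one_mul, restrictCoupling_empty, gibbsRatio_zero hz]

/-- **Multiplicativity of the bond weights** `M_c(K₁ ∪ K₂) = M_c(K₁) M_c(K₂)` whenever the
supports of `K₁`, `K₂` are disjoint (the tree's `bondWeight_union` verbatim with `c|_K` for `τ 1_K`).
[cite: Ueltschi1999, §2.3 (ρ factorises over components)] -/
theorem bondWeightC_union (hz : atomicPartitionFn β U μ ≠ 0) (c : Bond Λ → ℂ) {K₁ K₂ : Finset (Bond Λ)}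
    (h : Disjoint (cellSupp Bond.verts K₁) (cellSupp Bond.verts K₂)) :
    bondWeightC β U μ c (K₁ ∪ K₂) = bondWeightC β U μ c K₁ * bondWeightC β U μ c K₂ := by
  have hK : Disjoint K₁ K₂ := disjoint_of_disjoint_cellSupp h
  rw [bondWeightC, bondWeightC, bondWeightC, sum_powerset_union_eq_sum_sum hK, Finset.sum_mul_sum]
  refine Finset.sum_congr rfl fun K₁' h₁ => Finset.sum_congr rfl fun K₂' h₂ => ?_
  have h₁' : K₁' ⊆ K₁ := Finset.mem_powerset.1 h₁
  have h₂' : K₂' ⊆ K₂ := Finset.mem_powerset.1 h₂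
  have hK' : Disjoint K₁' K₂' := Finset.disjoint_of_subset_left h₁' (Finset.disjoint_of_subset_right h₂' hK)
  have hsd : Disjoint (K₁ \ K₁') (K₂ \ K₂') :=
    Finset.disjoint_of_subset_left Finset.sdiff_subset (Finset.disjoint_of_subset_right Finset.sdiff_subset hK)
  have hc₁ : ∀ b, restrictCoupling c K₁' b ≠ 0 → b.1 ∈ cellSupp Bond.verts K₁ ∧ b.2.1 ∈ cellSupp Bond.verts K₁ :=
    fun b hb => endpoints_mem_cellSupp (h₁' (mem_of_restrictCoupling_ne_zero hb))
  have hc₂ : ∀ b, restrictCoupling c K₂' b ≠ 0 → b.1 ∈ cellSupp Bond.verts K₂ ∧ b.2.1 ∈ cellSupp Bond.verts K₂ :=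
    fun b hb => endpoints_mem_cellSupp (h₂' (mem_of_restrictCoupling_ne_zero hb))
  rw [union_sdiff_union_eq hK h₁' h₂', Finset.card_union_of_disjoint hsd, pow_add, restrictCoupling_union c hK',
    gibbsRatio_add hz h hc₁ hc₂]
  ring

/-- **The site activity for a bond-dependent coupling** on the bond universe `P`:
`ρ_c(A) = Σ_{X ⊆ P connected, supp X = A} M_c(X)`. [cite: Ueltschi1999, §2.3, §3 ("polymers are connected sets")] -/
def siteActivityC (P : Finset (Bond Λ)) (β U μ : ℂ) (c : Bond Λ → ℂ) : Finset Λ → ℂ :=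
  pushforwardActivity (cellSupp Bond.verts) (bondWeightC β U μ c) (connectedCellSets Bond.verts P)

/-- The site activity unfolded. [folklore] -/
theorem siteActivityC_apply (P : Finset (Bond Λ)) (β U μ : ℂ) (c : Bond Λ → ℂ) (A : Finset Λ) :
    siteActivityC P β U μ c A =
      ∑ X ∈ (connectedCellSets Bond.verts P).filter (fun X => cellSupp Bond.verts X = A),
        bondWeightC β U μ c X := rfl

/-- Two couplings whose restricted Gibbs factors agree on every bond set with endpoints in `A`
have the same site activity at `A`. [folklore] -/
theorem siteActivityC_congr_of_Zc (P : Finset (Bond Λ)) (β U μ : ℂ) {c c' : Bond Λ → ℂ} {A : Finset Λ}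
    (h : ∀ K : Finset (Bond Λ), (∀ b ∈ K, b.1 ∈ A ∧ b.2.1 ∈ A) →
      Zc β U μ (restrictCoupling c K) = Zc β U μ (restrictCoupling c' K)) :
    siteActivityC P β U μ c A = siteActivityC P β U μ c' A := by
  rw [siteActivityC_apply, siteActivityC_apply]
  refine Finset.sum_congr rfl fun X hX => ?_
  have hXA : cellSupp Bond.verts X = A := (Finset.mem_filter.1 hX).2
  unfold bondWeightC
  refine Finset.sum_congr rfl fun K' hK' => ?_
  have hsub : K' ⊆ X := Finset.mem_powerset.1 hK'
  rw [gibbsRatio, gibbsRatio, h K' (fun b hb => hXA ▸ endpoints_mem_cellSupp (hsub hb))]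

/-- **The polymer representation of the Gibbs factor for a bond-dependent coupling**
(bounds.tex Lemma 12.2, representation part): for every bond set `P` containing the support of `c`,
`Zc(β,U,μ;c) = z₀^{|Λ|} · Ξ^{polyInc}_{𝒫(Λ)}(siteActivityC P c)` (`z₀ ≠ 0`). The tree's
`Zc_hubbardCoupling_eq_mul_polymerPartitionFunction` verbatim with `c|_K` for `τ 1_K`.
[cite: Ueltschi1999, §2.3 (Tr e^{-βH_Λ} = e^{-βf₀|Λ|} Σ_{𝒜₁,…,𝒜_ℓ disjoint} Π ρ(𝒜_j))] -/
theorem Zc_eq_mul_polymerPartitionFunctionC (hz : atomicPartitionFn β U μ ≠ 0) (c : Bond Λ → ℂ)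
    (P : Finset (Bond Λ)) (hP : ∀ b, c b ≠ 0 → b ∈ P) :
    Zc β U μ c =
      atomicPartitionFn β U μ ^ Fintype.card Λ *
        polymerPartitionFunction polyInc (siteActivityC P β U μ c) (Finset.univ : Finset Λ).powerset := by
  have h0 : Zc β U μ (0 : Bond Λ → ℂ) ≠ 0 := Zc_zero_ne_zero hz
  have h1 : Zc β U μ c = Zc β U μ (0 : Bond Λ → ℂ) * gibbsRatio β U μ (restrictCoupling c P) := by
    rw [gibbsRatio, restrictCoupling_eq_self hP, mul_div_cancel₀ _ h0]
  have h2 : gibbsRatio β U μ (restrictCoupling c P) = ∑ K ∈ P.powerset, bondWeightC β U μ c K :=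
    (sum_powerset_sum_powerset_neg_one_pow_card_sdiff_mul (M := ℂ)
      (fun K => gibbsRatio β U μ (restrictCoupling c K)) P).symm
  have h3 := sum_powerset_eq_polymerPartitionFunction_cellSupp (verts := (Bond.verts : Bond Λ → Finset Λ))
    verts_nonempty (bondWeightC β U μ c) (bondWeightC_empty hz c) (fun K₁ K₂ h => bondWeightC_union hz c h) P
  have h4 : polymerPartitionFunction polyInc (siteActivityC P β U μ c) (Finset.univ : Finset Λ).powerset =
      polymerPartitionFunction polyInc (siteActivityC P β U μ c)
        ((connectedCellSets Bond.verts P).image (cellSupp Bond.verts)) :=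
    polymerPartitionFunction_eq_of_subset_of_eq_zero (fun A _ => Finset.mem_powerset.2 (Finset.subset_univ _))
      fun A _ hA => pushforwardActivity_eq_zero_of_not_mem_image hA
  rw [h1, h2, h3, Zc_zero, h4, siteActivityC]

/-- The right-hand side of the polymer representation as one quantity:
`z₀^{|Λ|} · Ξ^{polyInc}_{𝒫(Λ)}(siteActivityC P c)`. [folklore] -/
def polymerGasZ (P : Finset (Bond Λ)) (β U μ : ℂ) (c : Bond Λ → ℂ) : ℂ :=
  atomicPartitionFn β U μ ^ Fintype.card Λ *
    polymerPartitionFunction polyInc (siteActivityC P β U μ c) (Finset.univ : Finset Λ).powerset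

/-- The polymer representation, packaged: `Zc(c) = polymerGasZ P c` for `P ⊇ supp c`. [this file] -/
theorem Zc_eq_polymerGasZ (hz : atomicPartitionFn β U μ ≠ 0) (c : Bond Λ → ℂ) (P : Finset (Bond Λ))
    (hP : ∀ b, c b ≠ 0 → b ∈ P) : Zc β U μ c = polymerGasZ P β U μ c :=
  Zc_eq_mul_polymerPartitionFunctionC hz c P hP

/-! ### Smallness per bond: the weights are iterated differences of an entire function -/

/-- `M_c(K)` is the iterated finite difference, with step `s` in the coordinates of `K` at `0`, of
the entire function `d ↦ g(d·ĉ)` whenever `c = s ĉ`. [folklore] -/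
theorem bondWeightC_eq_iterDiff (β U μ : ℂ) (c ĉ : Bond Λ → ℂ) (s : ℂ) (hcs : ∀ b, c b = s * ĉ b)
    (K : Finset (Bond Λ)) :
    bondWeightC β U μ c K = iterDiff s K (fun d => gibbsRatio β U μ (d * ĉ)) 0 := by
  unfold bondWeightC iterDiff
  refine Finset.sum_congr rfl fun K' _ => ?_
  have hK' : restrictCoupling c K' = (0 + s • Set.indicator (↑K' : Set (Bond Λ)) 1) * ĉ := by
    funext b
    by_cases hb : b ∈ K' <;> simp [restrictCoupling_apply, hb, hcs]
  rw [hK']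

/-- **Smallness per bond** for bond-dependent couplings: if `|c_b| ≤ s ≤ 1` for all bonds then
`|M_c(K)| ≤ (e² s)^{|K|} · r^{|supp K|}` (`r = siteRatio`; `r = 1` for real `β, U, μ`) — the tree's
`norm_bondWeight_le` ported (Cauchy bound for the iterated difference, radius `1`).
[cite: Ueltschi1999, §2.3 and §3 (|ρ(𝒜)| ≤ e^{-c|𝒜|} for small βt)] -/
theorem norm_bondWeightC_le (hz : atomicPartitionFn β U μ ≠ 0) {s : ℝ} (hs0 : 0 ≤ s) (hs1 : s ≤ 1)
    {c : Bond Λ → ℂ} (hc : ∀ b, ‖c b‖ ≤ s) (K : Finset (Bond Λ)) :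
    ‖bondWeightC β U μ c K‖ ≤
      (Real.exp 2 * s) ^ K.card * siteRatio β U μ ^ (cellSupp Bond.verts K).card := by
  -- the normalised coupling `ĉ = c / s` (`0` if `s = 0`, in which case `c = 0`)
  set ĉ : Bond Λ → ℂ := fun b => if s = 0 then 0 else c b / s with hĉ
  have hcs : ∀ b, c b = (s : ℂ) * ĉ b := by
    intro b
    by_cases h0 : s = 0
    · have hcb : c b = 0 := by
        have h := hc b
        rw [h0] at h
        exact norm_le_zero_iff.1 h
      simp [hĉ, h0, hcb]
    · have hs : (s : ℂ) ≠ 0 := Complex.ofReal_ne_zero.2 h0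
      simp only [hĉ, if_neg h0]
      field_simp
  have hĉ1 : ∀ b, ‖ĉ b‖ ≤ 1 := by
    intro b
    by_cases h0 : s = 0
    · simp [hĉ, h0]
    · simp only [hĉ, if_neg h0, norm_div, Complex.norm_real, Real.norm_eq_abs, abs_of_nonneg hs0]
      exact div_le_one_of_le₀ (hc b) hs0
  have hB : ∀ d : Bond Λ → ℂ, (∀ b, ‖d b‖ ≤ ‖(s : ℂ)‖ + 1) → (∀ b ∉ K, d b = 0) →
      ‖gibbsRatio β U μ (d * ĉ)‖ ≤ Real.exp (2 * K.card) * siteRatio β U μ ^ (cellSupp Bond.verts K).card := by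
    intro d hd hK
    have hK' : ∀ b ∉ K, (d * ĉ) b = 0 := fun b hb => by rw [Pi.mul_apply, hK b hb, zero_mul]
    have hsupp : ∀ b, (d * ĉ) b ≠ 0 → b.1 ∈ cellSupp Bond.verts K ∧ b.2.1 ∈ cellSupp Bond.verts K := by
      intro b hb
      have hbK : b ∈ K := by
        by_contra h
        exact hb (hK' b h)
      exact endpoints_mem_cellSupp hbK
    refine (norm_gibbsRatio_le hz hsupp).trans
      (mul_le_mul_of_nonneg_right ?_ (pow_nonneg (siteRatio_nonneg _ _ _) _))
    rw [Real.exp_le_exp]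
    have hd2 : ∀ b, ‖(d * ĉ) b‖ ≤ 2 := by
      intro b
      rw [Pi.mul_apply, norm_mul]
      have h1 := hd b
      rw [Complex.norm_real, Real.norm_eq_abs, abs_of_nonneg hs0] at h1
      calc ‖d b‖ * ‖ĉ b‖ ≤ (s + 1) * 1 := mul_le_mul h1 (hĉ1 b) (norm_nonneg _) (by linarith)
        _ ≤ 2 := by linarith
    refine (norm_hopSum_le_mul_card (s := 2) hd2 hK').trans (le_of_eq ?_)
    ring
  have hg : Differentiable ℂ (fun d : Bond Λ → ℂ => gibbsRatio β U μ (d * ĉ)) :=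
    (differentiable_gibbsRatio β U μ).comp (differentiable_id.mul (differentiable_const ĉ))
  have h := norm_iterDiff_zero_le hg one_pos K hB
  rw [div_one, Complex.norm_real, Real.norm_eq_abs, abs_of_nonneg hs0] at h
  rw [bondWeightC_eq_iterDiff β U μ c ĉ s hcs K]
  refine h.trans (le_of_eq ?_)
  rw [mul_pow, ← Real.exp_nat_mul, mul_comm (K.card : ℝ) 2]
  ring

end General

end Summit.HubbardSuperconductivity.HubbardLadder.Bounds

end
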